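import Literature.Topology.FourManifolds.SurgeryGlueData
import HarnessLib

/-!
# Cutting a ball piece off a reconstruction datum

Second cutting step of the reconstruction of a manifold from the pieces of the Ricci flow with
surgery (R. Hamilton, *Four-manifolds with positive isotropic curvature*, Comm. Anal. Geom. 5
(1997), §1.1 pp. 3–4; `SurgeryGlueData.lean`): given a reconstruction datum `G` of `Q` over `M'`
and a ball piece `j₀`,

* `SurgeryGlueData.collar j₀ : BallCollarData E n Q` — the ball chart of the piece together with
  the chart of its surgery ball of `M'` read through `e⁻¹` (`CollarNeck.lean`); whence the
  **collar neck** of `j₀`, its far and near sides (`BallCollarData.far/near`, disjoint and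
  covering `Q` off the middle sphere — the data of a `surgery` in
  `Literature.Geometry.Riemannian.IsNeckSurgeryResolvable`), and the near capped side as a
  twisted sphere;
* `SurgeryGlueData.ballCut j₀ : SurgeryGlueData E n (collar j₀).far.Capped M'` — **the
  reconstruction datum of the far capped side**: all other pieces are carried over
  (`NeckCapData.liftMap`, `NeckCapData.transport`, `NeckCapTransport.lean`), the piece `j₀`
  disappears, and the cap becomes a *matched* ball piece, its chart `inr` being radially
  compatible with the surgery-ball chart of `j₀` through the transported `e`
  (`e (ψ (θ, t)) = ι' ((1 + ε ρ t) θ)`);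
* `complexity_ballCut : (ballCut j₀).complexity + 1 = G.complexity`.

## References

* R. S. Hamilton, *Four-manifolds with positive isotropic curvature*, Comm. Anal. Geom. 5 (1997)
  1–92, §1.1 pp. 3–4. [Hamilton1997]
* B.-L. Chen, X.-P. Zhu, *Ricci flow with surgery on four-manifolds with positive isotropic
  curvature*, J. Differential Geom. 74 (2006), Thm. 1.1. [ChenZhu2006]
-/

open scoped Manifold ContDiff Topology
open Set Function Metric Module Filter OpenPartialHomeomorph Topology

noncomputable section

namespace Literature.Topology.FourManifolds

open CollarProfile TubeProfile

namespace SurgeryGlueData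

variable {E : Type} [NormedAddCommGroup E] [InnerProductSpace ℝ E] {n : ℕ} [Fact (finrank ℝ E = n + 1)]
  {Q M' : Type} [TopologicalSpace Q] [ChartedSpace E Q] [TopologicalSpace M'] [ChartedSpace E M']
  (G : SurgeryGlueData E n Q M') (j₀ : G.P.Ib)

/-! ### The collar datum of a ball piece -/

/-- The surgery-ball chart of `j₀` as an open partial homeomorphism `E ≅ range`. [folklore] -/
def ballMPH : OpenPartialHomeomorph E M' :=
  haveI : Nonempty E := ⟨0⟩
  (G.P.isOpenEmbedding_ballM j₀).toOpenPartialHomeomorph _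

/-- `ballMPH_apply`: elementary bookkeeping (ballMPH apply). [folklore] -/
@[simp] theorem ballMPH_apply (y : E) : G.ballMPH j₀ y = G.P.ballM j₀ y := rfl

/-- `ballMPH_coe`: elementary bookkeeping (ballMPH coe). [folklore] -/
@[simp] theorem ballMPH_coe : ⇑(G.ballMPH j₀) = G.P.ballM j₀ := rfl

/-- `ballMPH_source`: elementary bookkeeping (ballMPH source). [folklore] -/
@[simp] theorem ballMPH_source : (G.ballMPH j₀).source = univ := by
  haveI : Nonempty E := ⟨0⟩
  exact IsOpenEmbedding.toOpenPartialHomeomorph_source _ _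

/-- `ballMPH_target`: elementary bookkeeping (ballMPH target). [folklore] -/
@[simp] theorem ballMPH_target : (G.ballMPH j₀).target = range (G.P.ballM j₀) := by
  haveI : Nonempty E := ⟨0⟩
  exact IsOpenEmbedding.toOpenPartialHomeomorph_target _ _

/-- `ballMPH_symm_apply`: elementary bookkeeping (ballMPH symm apply). [folklore] -/
theorem ballMPH_symm_apply (y : E) : (G.ballMPH j₀).symm (G.P.ballM j₀ y) = y := by
  haveI : Nonempty E := ⟨0⟩
  exact IsOpenEmbedding.toOpenPartialHomeomorph_left_inv _ _

/-- `contMDiffOn_ballMPH_symm`: elementary bookkeeping (contMDiffOn ballMPH symm). [folklore] -/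
theorem contMDiffOn_ballMPH_symm [IsManifold 𝓘(ℝ, E) ∞ M'] :
    ContMDiffOn 𝓘(ℝ, E) 𝓘(ℝ, E) ∞ (G.ballMPH j₀).symm (range (G.P.ballM j₀)) := by
  haveI : Nonempty E := ⟨0⟩
  exact contMDiffOn_symm_of_isSmoothEmbedding (G.P.isSmoothEmbedding_ballM j₀) (G.P.isOpenEmbedding_ballM j₀)

/-- **The collar chart** `c = e⁻¹ ∘ ι'` of the ball piece `j₀`: the surgery-ball chart of `M'`
pulled back by `e`. [folklore] -/
def collarChart : OpenPartialHomeomorph E Q := (G.ballMPH j₀).trans G.P.e.symm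

/-- `collarChart_apply`: elementary bookkeeping (collarChart apply). [folklore] -/
@[simp] theorem collarChart_apply (y : E) : G.collarChart j₀ y = G.P.e.symm (G.P.ballM j₀ y) := rfl

/-- `collarChart_source`: elementary bookkeeping (collarChart source). [folklore] -/
theorem collarChart_source : (G.collarChart j₀).source = G.P.ballM j₀ ⁻¹' G.P.e.target := by
  simp [collarChart]

/-- `mem_collarChart_source`: elementary bookkeeping (mem collarChart source). [folklore] -/
theorem mem_collarChart_source {y : E} : y ∈ (G.collarChart j₀).source ↔ G.P.ballM j₀ y ∈ G.P.e.target := by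
  rw [collarChart_source]; rfl

/-- `contMDiffOn_collarChart`: elementary bookkeeping (contMDiffOn collarChart). [folklore] -/
theorem contMDiffOn_collarChart [IsManifold 𝓘(ℝ, E) ∞ M'] :
    ContMDiffOn 𝓘(ℝ, E) 𝓘(ℝ, E) ∞ (G.collarChart j₀) (G.collarChart j₀).source := by
  rw [collarChart_source]
  intro y hy
  exact ((G.P.contMDiffOn_e_symm.contMDiffAt (G.P.e.open_target.mem_nhds hy)).comp y
    (G.P.isSmoothEmbedding_ballM j₀).contMDiff.contMDiffAt).contMDiffWithinAt

/-- `contMDiffOn_collarChart_symm`: elementary bookkeeping (contMDiffOn collarChart symm). [folklore] -/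
theorem contMDiffOn_collarChart_symm [IsManifold 𝓘(ℝ, E) ∞ M'] :
    ContMDiffOn 𝓘(ℝ, E) 𝓘(ℝ, E) ∞ (G.collarChart j₀).symm (G.collarChart j₀).target := by
  have ht : (G.collarChart j₀).target = G.P.e.source ∩ G.P.e ⁻¹' range (G.P.ballM j₀) := by
    simp [collarChart]
  rw [ht]
  intro p hp
  have h1 : ContMDiffAt 𝓘(ℝ, E) 𝓘(ℝ, E) ∞ G.P.e p := G.P.contMDiffOn_e.contMDiffAt (G.P.e.open_source.mem_nhds hp.1)
  have h2 : ContMDiffWithinAt 𝓘(ℝ, E) 𝓘(ℝ, E) ∞ (G.ballMPH j₀).symm (range (G.P.ballM j₀)) (G.P.e p) :=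
    G.contMDiffOn_ballMPH_symm j₀ _ hp.2
  exact (h2.comp p h1.contMDiffWithinAt (fun q hq => hq.2)).mono (fun q hq => hq)

/-- `shell_subset_collarChart_source`: elementary bookkeeping (shell subset collarChart source). [folklore] -/
theorem shell_subset_collarChart_source :
    shell (G.P.ballε j₀) (G.P.ballδ j₀) ⊆ (G.collarChart j₀).source := by
  intro y hy
  rw [mem_collarChart_source]
  exact G.ballM_shell j₀ ⟨y, hy, rfl⟩

/-- `collarChart_image_sphere`: elementary bookkeeping (collarChart image sphere). [folklore] -/
theorem collarChart_image_sphere : G.collarChart j₀ '' sphere 0 1 = G.P.ball j₀ '' sphere 0 1 := by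
  have h : G.collarChart j₀ '' sphere 0 1 = G.P.e.symm '' (G.P.ballM j₀ '' sphere 0 1) := by
    rw [← image_comp]; rfl
  rw [h, G.ballM_sphere j₀, G.P.e.symm_image_image_of_subset_source' (G.ballSphere_subset_source j₀)]
  rfl

/-- `collarChart_image_inner_subset`: elementary bookkeeping (collarChart image inner subset). [folklore] -/
theorem collarChart_image_inner_subset :
    G.collarChart j₀ '' {y : E | 1 - G.P.ballδ j₀ < ‖y‖ ∧ ‖y‖ < 1} ⊆ G.P.ball j₀ '' Metric.ball 0 1 := by
  rintro _ ⟨y, ⟨hy1, hy2⟩, rfl⟩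
  have hyt : G.P.ballM j₀ y ∈ G.P.e.target :=
    G.ballM_shell j₀ ⟨y, ⟨hy1, by linarith [G.P.ballε_pos j₀]⟩, rfl⟩
  exact G.ballM_inner j₀ ⟨_, ⟨⟨y, mem_ball_zero_iff.2 hy2, rfl⟩, hyt⟩, rfl⟩

/-- `collarChart_image_outerAnnulus_subset_N`: elementary bookkeeping (collarChart image outerAnnulus subset N). [folklore] -/
theorem collarChart_image_outerAnnulus_subset_N :
    G.collarChart j₀ '' outerAnnulus (G.P.ballε j₀) ⊆ G.P.N := by
  rintro _ ⟨y, hy, rfl⟩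
  exact G.ballM_outer j₀ ⟨_, ⟨y, hy, rfl⟩, rfl⟩

/-- `disjoint_collarChart_outer`: elementary bookkeeping (disjoint collarChart outer). [folklore] -/
theorem disjoint_collarChart_outer :
    Disjoint (G.collarChart j₀ '' outerAnnulus (G.P.ballε j₀)) (G.P.ball j₀ '' Metric.ball 0 1) := by
  refine Set.disjoint_left.2 fun p hp hq => ?_
  have hN := G.collarChart_image_outerAnnulus_subset_N j₀ hp
  rw [GluePieces.mem_N_iff] at hN
  exact hN (Sum.inr (Sum.inl j₀)) hq

/-- **The collar datum of the ball piece `j₀`** (`BallCollarData`, `CollarNeck.lean`). [folklore] -/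
def collar [IsManifold 𝓘(ℝ, E) ∞ M'] : BallCollarData E n Q where
  ι := G.P.ball j₀
  c := G.collarChart j₀
  ε := G.P.ballε j₀
  δ := G.P.ballδ j₀
  ε_pos := G.P.ballε_pos j₀
  δ_pos := G.P.ballδ_pos j₀
  δ_lt_one := G.P.ballδ_lt_one j₀
  isSmoothEmbedding_ι := G.P.isSmoothEmbedding_ball j₀
  isOpen_range_ι := G.P.isOpen_range_ball j₀
  contMDiffOn_c := G.contMDiffOn_collarChart j₀
  contMDiffOn_c_symm := G.contMDiffOn_collarChart_symm j₀
  shell_subset := G.shell_subset_collarChart_source j₀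
  image_sphere := G.collarChart_image_sphere j₀
  image_inner_subset := G.collarChart_image_inner_subset j₀
  disjoint_outer := G.disjoint_collarChart_outer j₀

variable [IsManifold 𝓘(ℝ, E) ∞ M']

/-- `collar_ι`: elementary bookkeeping (collar ι). [folklore] -/
@[simp] theorem collar_ι : (G.collar j₀).ι = G.P.ball j₀ := rfl
/-- `collar_c`: elementary bookkeeping (collar c). [folklore] -/
@[simp] theorem collar_c : (G.collar j₀).c = G.collarChart j₀ := rfl
/-- `collar_ε`: elementary bookkeeping (collar ε). [folklore] -/
@[simp] theorem collar_ε : (G.collar j₀).ε = G.P.ballε j₀ := rfl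
/-- `collar_δ`: elementary bookkeeping (collar δ). [folklore] -/
@[simp] theorem collar_δ : (G.collar j₀).δ = G.P.ballδ j₀ := rfl

/-- The collar neck: `ψ (θ, t) = e⁻¹ (ι' ((1 + ε ρ t) • θ))`. [folklore] -/
theorem neck_apply (θ : sphere (0 : E) 1) (t : ℝ) :
    (G.collar j₀).neck (θ, t) = G.P.e.symm (G.P.ballM j₀ (collarRad (G.P.ballε j₀) t • (θ : E))) := rfl

omit [IsManifold 𝓘(ℝ, E) ∞ M'] in
/-- The radial argument of the neck is in the shell. [folklore] -/
theorem neck_arg_mem_shell (θ : sphere (0 : E) 1) (t : ℝ) :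
    collarRad (G.P.ballε j₀) t • (θ : E) ∈ shell (G.P.ballε j₀) (G.P.ballδ j₀) := by
  have hr := collarRad_pos (G.P.ballε_pos j₀) t
  rw [mem_shell, BallCollarData.norm_smul_sphere θ hr]
  exact ⟨by linarith [one_lt_collarRad (G.P.ballε_pos j₀) t, G.P.ballδ_pos j₀], collarRad_lt (G.P.ballε_pos j₀) t⟩

omit [IsManifold 𝓘(ℝ, E) ∞ M'] in
/-- The surgery-ball point of the neck is in the target of `e`. [folklore] -/
theorem ballM_neck_arg_mem_target (θ : sphere (0 : E) 1) (t : ℝ) :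
    G.P.ballM j₀ (collarRad (G.P.ballε j₀) t • (θ : E)) ∈ G.P.e.target :=
  G.ballM_shell j₀ ⟨_, G.neck_arg_mem_shell j₀ θ t, rfl⟩

/-- The neck lies in the source of `e`. [folklore] -/
theorem neck_mem_source (θ : sphere (0 : E) 1) (t : ℝ) : (G.collar j₀).neck (θ, t) ∈ G.P.e.source := by
  rw [neck_apply]; exact G.P.e.map_target (G.ballM_neck_arg_mem_target j₀ θ t)

/-- `e (ψ (θ, t)) = ι' ((1 + ε ρ t) • θ)`. [folklore] -/
theorem e_neck (θ : sphere (0 : E) 1) (t : ℝ) :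
    G.P.e ((G.collar j₀).neck (θ, t)) = G.P.ballM j₀ (collarRad (G.P.ballε j₀) t • (θ : E)) := by
  rw [neck_apply, G.P.e.right_inv (G.ballM_neck_arg_mem_target j₀ θ t)]

/-- The neck lies in the pulled-back shell, hence in the footprint of `j₀`. [folklore] -/
theorem neck_mem_footB (θ : sphere (0 : E) 1) (t : ℝ) : (G.collar j₀).neck (θ, t) ∈ G.P.footB j₀ :=
  Or.inr ⟨_, ⟨_, G.neck_arg_mem_shell j₀ θ t, rfl⟩, rfl⟩

/-- The near side with the middle sphere lies in the footprint of `j₀`. [folklore] -/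
theorem nearSet_union_midSphere_subset_footB :
    (G.collar j₀).nearSet ∪ (G.collar j₀).midSphere ⊆ G.P.footB j₀ := by
  rw [BallCollarData.nearSet_union_midSphere]
  rintro p (⟨x, -, rfl⟩ | ⟨y, ⟨hy1, hy2⟩, rfl⟩)
  · exact Or.inl ⟨x, rfl⟩
  · refine Or.inr ⟨_, ⟨y, ⟨?_, ?_⟩, rfl⟩, rfl⟩
    · linarith [G.P.ballδ_pos j₀]
    · exact hy2.trans_lt (collarRad_lt (G.P.ballε_pos j₀) 0)

/-- The index of the ball piece `j₀`. [folklore] -/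
abbrev idx : G.P.Idx := Sum.inr (Sum.inl j₀)

/-- **Every other footprint lies in the far side.** [folklore] -/
theorem foot_subset_farSet [T2Space Q] [IsManifold 𝓘(ℝ, E) ∞ Q] {a : G.P.Idx} (ha : a ≠ G.idx j₀) :
    G.P.foot a ⊆ (G.collar j₀).farSet := by
  intro p hp hq
  exact Set.disjoint_left.1 (G.disjoint_foot a (G.idx j₀) ha) hp (G.nearSet_union_midSphere_subset_footB j₀ hq)

/-- Every other piece lies in the far side. [folklore] -/
theorem piece_subset_farSet [T2Space Q] [IsManifold 𝓘(ℝ, E) ∞ Q] {a : G.P.Idx} (ha : a ≠ G.idx j₀) :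
    G.P.piece a ⊆ (G.collar j₀).farSet :=
  (G.P.piece_subset_foot a).trans (G.foot_subset_farSet j₀ ha)

/-- The common part off the footprint of `j₀` lies in the far side. [folklore] -/
theorem mem_farSet_of_not_mem_footB [T2Space Q] [IsManifold 𝓘(ℝ, E) ∞ Q] {p : Q} (hpf : p ∉ G.P.footB j₀) :
    p ∈ (G.collar j₀).farSet := fun hq =>
  hpf (G.nearSet_union_midSphere_subset_footB j₀ hq)

/-! ### The far capped side -/

variable [T2Space Q] [IsManifold 𝓘(ℝ, E) ∞ Q]

/-- Local notation for the far side datum. -/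
local notation "Dfar" => BallCollarData.far (SurgeryGlueData.collar G j₀)

/-- Far points of the neck: `ψ (θ, t)` for `t > 0`. [folklore] -/
theorem neck_mem_farSet (θ : sphere (0 : E) 1) {t : ℝ} (ht : 0 < t) : (G.collar j₀).neck (θ, t) ∈ ((Dfar).side : Set Q) :=
  (G.collar j₀).neck_mem_farSet θ ht

/-- A nonzero cap point is the neck point `ψ (x/‖x‖, ‖x‖)`. [folklore] -/
theorem inr_eq_inl_neck {x : E} (hx : x ≠ 0) :
    (Dfar).glueData.inr x = (Dfar).glueData.inl ⟨(G.collar j₀).neck (unitDir (unitSpherePoint n) x, ‖x‖),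
      G.neck_mem_farSet j₀ _ (norm_pos_iff.2 hx)⟩ := by
  have h := (Dfar).inl_eq_inr (unitDir (unitSpherePoint n) x) (norm_pos_iff.2 hx)
  rw [norm_smul_coe_unitDir _ hx] at h
  exact h.symm

/-- The range of the cap disc consists of the centre and of neck points. [folklore] -/
theorem eq_zero_or_exists_of_mem_range_inr {p : (Dfar).Capped} (hp : p ∈ range (Dfar).glueData.inr) :
    p = (Dfar).glueData.inr 0 ∨ ∃ (θ : sphere (0 : E) 1) (t : ℝ) (ht : 0 < t),
      p = (Dfar).glueData.inl ⟨(G.collar j₀).neck (θ, t), G.neck_mem_farSet j₀ θ ht⟩ := by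
  obtain ⟨x, rfl⟩ := hp
  rcases eq_or_ne x 0 with rfl | hx
  · exact Or.inl rfl
  · exact Or.inr ⟨_, _, norm_pos_iff.2 hx, G.inr_eq_inl_neck j₀ hx⟩

/-- The range of the cap disc off the centre lies in `inlSet` of the footprint of `j₀`. [folklore] -/
theorem range_inr_subset : range (Dfar).glueData.inr ⊆ insert ((Dfar).glueData.inr 0) ((Dfar).inlSet (G.P.footB j₀)) := by
  intro p hp
  rcases G.eq_zero_or_exists_of_mem_range_inr j₀ hp with rfl | ⟨θ, t, ht, rfl⟩
  · exact mem_insert _ _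
  · exact Or.inr ((Dfar).inl_mem_inlSet_iff.2 (G.neck_mem_footB j₀ θ t))

/-! ### The new pieces -/

/-- The charts of the other pieces have values in the far side. [folklore] -/
theorem tube_mem_farSet (i : G.P.It) (q : sphere (0 : E) 1 × ℝ) : G.P.tube i q ∈ ((Dfar).side : Set Q) :=
  G.foot_subset_farSet j₀ (a := Sum.inl i) (by simp [idx]) (G.P.range_tube_subset_foot i ⟨q, rfl⟩)

/-- `ball_mem_farSet`: elementary bookkeeping (ball mem farSet). [folklore] -/
theorem ball_mem_farSet (j : {j : G.P.Ib // j ≠ j₀}) (x : E) : G.P.ball j.1 x ∈ ((Dfar).side : Set Q) :=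
  G.foot_subset_farSet j₀ (a := Sum.inr (Sum.inl j.1)) (by simpa [idx] using j.2) (G.P.range_ball_subset_foot j.1 ⟨x, rfl⟩)

/-- `mball_mem_farSet`: elementary bookkeeping (mball mem farSet). [folklore] -/
theorem mball_mem_farSet (k : G.P.Im) (x : E) : G.P.mball k x ∈ ((Dfar).side : Set Q) :=
  G.foot_subset_farSet j₀ (a := Sum.inr (Sum.inr k)) (by simp [idx]) (G.P.range_mball_subset_foot k ⟨x, rfl⟩)

/-- The derivative of the new matching profile `1 + ε ρ` is positive. [folklore] -/
theorem deriv_collarRad_pos {ε : ℝ} (hε : 0 < ε) (s : ℝ) : 0 < deriv (collarRad ε) s := by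
  have h : HasDerivAt (collarRad ε) (ε * halfProfileDeriv |s|) s := by
    unfold collarRad
    exact ((hasDerivAt_tubeProfile s).const_mul ε).const_add 1
  rw [h.deriv]
  exact mul_pos hε (halfProfileDeriv_pos _)

/-- **The pieces of the far capped side.** [folklore] -/
def cutPieces : GluePieces E n (Dfar).Capped M' where
  e := (Dfar).transport G.P.e
  contMDiffOn_e := (Dfar).contMDiffOn_transport G.P.contMDiffOn_e
  contMDiffOn_e_symm := (Dfar).contMDiffOn_transport_symm G.P.contMDiffOn_e_symm
  It := G.P.It
  Ib := {j : G.P.Ib // j ≠ j₀}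
  Im := G.P.Im ⊕ PUnit
  fintypeIt := inferInstance
  fintypeIb := by classical exact inferInstance
  fintypeIm := inferInstance
  tube i := (Dfar).liftMap (G.P.tube i) (G.tube_mem_farSet j₀ i)
  tubeM := G.P.tubeM
  tubeε := G.P.tubeε
  tubeδ := G.P.tubeδ
  ball j := (Dfar).liftMap (G.P.ball j.1) (G.ball_mem_farSet j₀ j)
  ballM j := G.P.ballM j.1
  ballε j := G.P.ballε j.1
  ballδ j := G.P.ballδ j.1
  mball := fun k => match k with
    | Sum.inl k => (Dfar).liftMap (G.P.mball k) (G.mball_mem_farSet j₀ k)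
    | Sum.inr _ => (Dfar).glueData.inr
  mballM := fun k => match k with
    | Sum.inl k => G.P.mballM k
    | Sum.inr _ => G.P.ballM j₀
  mprof := fun k => match k with
    | Sum.inl k => G.P.mprof k
    | Sum.inr _ => collarRad (G.P.ballε j₀)
  isSmoothEmbedding_tube i := (Dfar).isSmoothEmbedding_liftMap (G.P.isSmoothEmbedding_tube i) _
  isOpen_range_tube i := (Dfar).isOpen_range_liftMap (G.P.isOpen_range_tube i) _
  isSmoothEmbedding_tubeM := G.P.isSmoothEmbedding_tubeM
  isOpen_range_tubeM := G.P.isOpen_range_tubeM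
  isSmoothEmbedding_ball j := (Dfar).isSmoothEmbedding_liftMap (G.P.isSmoothEmbedding_ball j.1) _
  isOpen_range_ball j := (Dfar).isOpen_range_liftMap (G.P.isOpen_range_ball j.1) _
  isSmoothEmbedding_ballM j := G.P.isSmoothEmbedding_ballM j.1
  isOpen_range_ballM j := G.P.isOpen_range_ballM j.1
  isSmoothEmbedding_mball k := by
    rcases k with k | u
    · exact (Dfar).isSmoothEmbedding_liftMap (G.P.isSmoothEmbedding_mball k) _
    · exact (Dfar).glueData.isSmoothEmbedding_inr
  isOpen_range_mball k := by
    rcases k with k | u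
    · exact (Dfar).isOpen_range_liftMap (G.P.isOpen_range_mball k) _
    · exact (Dfar).glueData.isOpen_range_inr
  isSmoothEmbedding_mballM k := by
    rcases k with k | u
    · exact G.P.isSmoothEmbedding_mballM k
    · exact G.P.isSmoothEmbedding_ballM j₀
  isOpen_range_mballM k := by
    rcases k with k | u
    · exact G.P.isOpen_range_mballM k
    · exact G.P.isOpen_range_ballM j₀
  tubeε_pos := G.P.tubeε_pos
  tubeδ_pos := G.P.tubeδ_pos
  tubeδ_lt_one := G.P.tubeδ_lt_one
  ballε_pos j := G.P.ballε_pos j.1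
  ballδ_pos j := G.P.ballδ_pos j.1
  ballδ_lt_one j := G.P.ballδ_lt_one j.1
  contDiff_mprof k := by
    rcases k with k | u
    · exact G.P.contDiff_mprof k
    · exact contDiff_collarRad _
  strictMono_mprof k := by
    rcases k with k | u
    · exact G.P.strictMono_mprof k
    · exact strictMono_collarRad (G.P.ballε_pos j₀)
  deriv_mprof_pos k := by
    rcases k with k | u
    · exact G.P.deriv_mprof_pos k
    · exact deriv_collarRad_pos (G.P.ballε_pos j₀)
  mprof_pos k s hs := by
    rcases k with k | u
    · exact G.P.mprof_pos k s hs
    · exact collarRad_pos (G.P.ballε_pos j₀) s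

/-! ### The pieces and footprints of the cut datum -/

/-- Local notation for the cut pieces. -/
local notation "Cut" => SurgeryGlueData.cutPieces G j₀

/-- `cutPieces_e`: elementary bookkeeping (cutPieces e). [folklore] -/
@[simp] theorem cutPieces_e : (Cut).e = (Dfar).transport G.P.e := rfl

/-- A pulled-back collar shell lies in the far side if it lies in another footprint. [folklore] -/
theorem symm_image_subset_farSet {T : Set M'} {a : G.P.Idx} (ha : a ≠ G.idx j₀) (h : G.P.e.symm '' T ⊆ G.P.foot a) :
    G.P.e.symm '' T ⊆ (G.collar j₀).farSet :=
  h.trans (G.foot_subset_farSet j₀ ha)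

omit [IsManifold 𝓘(ℝ, E) ∞ M'] [T2Space Q] [IsManifold 𝓘(ℝ, E) ∞ Q] in
/-- The collar shells of the tubes, pulled back, lie in the tube footprint. [folklore] -/
theorem symm_image_tubeM_shell_subset (i : G.P.It) (b : Bool) :
    G.P.e.symm '' (G.P.tubeM i b '' shell (G.P.tubeε i b) (G.P.tubeδ i b)) ⊆ G.P.foot (Sum.inl i) := by
  intro p hp
  exact Or.inr (mem_iUnion.2 ⟨b, hp⟩)

omit [IsManifold 𝓘(ℝ, E) ∞ M'] [T2Space Q] [IsManifold 𝓘(ℝ, E) ∞ Q] in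
/-- The collar shell of another ball, pulled back, lies in its footprint. [folklore] -/
theorem symm_image_ballM_shell_subset (j : G.P.Ib) :
    G.P.e.symm '' (G.P.ballM j '' shell (G.P.ballε j) (G.P.ballδ j)) ⊆ G.P.foot (Sum.inr (Sum.inl j)) :=
  fun _ hp => Or.inr hp

/-- The collar shells of the tubes lie in the target of the transported `e`. [folklore] -/
theorem tubeM_shell_subset_target (i : G.P.It) (b : Bool) :
    G.P.tubeM i b '' shell (G.P.tubeε i b) (G.P.tubeδ i b) ⊆ (Cut).e.target :=
  (Dfar).subset_transport_target (G.tubeM_shell i b)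
    (G.symm_image_subset_farSet j₀ (a := Sum.inl i) (by simp [idx]) (G.symm_image_tubeM_shell_subset i b))

/-- The collar shell of another ball lies in the target of the transported `e`. [folklore] -/
theorem ballM_shell_subset_target (j : {j : G.P.Ib // j ≠ j₀}) :
    G.P.ballM j.1 '' shell (G.P.ballε j.1) (G.P.ballδ j.1) ⊆ (Cut).e.target :=
  (Dfar).subset_transport_target (G.ballM_shell j.1)
    (G.symm_image_subset_farSet j₀ (a := Sum.inr (Sum.inl j.1)) (by simpa [idx] using j.2) (G.symm_image_ballM_shell_subset j.1))

/-- The new index of an old tube. [folklore] -/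
theorem cutPieces_foot_inl (i : G.P.It) : (Cut).foot (Sum.inl i) = (Dfar).inlSet (G.P.foot (Sum.inl i)) := by
  change range ((Dfar).liftMap (G.P.tube i) _) ∪ ⋃ b, (Cut).e.symm '' (G.P.tubeM i b '' shell (G.P.tubeε i b) (G.P.tubeδ i b)) =
    (Dfar).inlSet (range (G.P.tube i) ∪ ⋃ b, G.P.e.symm '' (G.P.tubeM i b '' shell (G.P.tubeε i b) (G.P.tubeδ i b)))
  rw [NeckCapData.inlSet_union, NeckCapData.inlSet_iUnion, NeckCapData.range_liftMap]
  congr 1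
  refine iUnion_congr fun b => ?_
  rw [cutPieces_e, (Dfar).transport_symm_image (G.tubeM_shell_subset_target j₀ i b)]

/-- The footprint of an old ball. [folklore] -/
theorem cutPieces_foot_ball (j : {j : G.P.Ib // j ≠ j₀}) :
    (Cut).foot (Sum.inr (Sum.inl j)) = (Dfar).inlSet (G.P.foot (Sum.inr (Sum.inl j.1))) := by
  change range ((Dfar).liftMap (G.P.ball j.1) _) ∪ (Cut).e.symm '' (G.P.ballM j.1 '' shell (G.P.ballε j.1) (G.P.ballδ j.1)) =
    (Dfar).inlSet (range (G.P.ball j.1) ∪ G.P.e.symm '' (G.P.ballM j.1 '' shell (G.P.ballε j.1) (G.P.ballδ j.1)))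
  rw [NeckCapData.inlSet_union, NeckCapData.range_liftMap, cutPieces_e, (Dfar).transport_symm_image (G.ballM_shell_subset_target j₀ j)]
  rfl

/-- The footprint of an old matched ball. [folklore] -/
theorem cutPieces_foot_mball (k : G.P.Im) :
    (Cut).foot (Sum.inr (Sum.inr (Sum.inl k))) = (Dfar).inlSet (G.P.foot (Sum.inr (Sum.inr k))) := by
  change range ((Dfar).liftMap (G.P.mball k) _) = (Dfar).inlSet (range (G.P.mball k))
  rw [NeckCapData.range_liftMap]
  rfl

/-- The footprint of the new matched ball (the cap) is the range of `inr`. [folklore] -/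
theorem cutPieces_foot_new (u : PUnit) : (Cut).foot (Sum.inr (Sum.inr (Sum.inr u))) = range (Dfar).glueData.inr := rfl

/-- The old index of a new index; the new cap is sent to `j₀` itself. [folklore] -/
def oldIdx : (Cut).Idx → G.P.Idx
  | Sum.inl i => Sum.inl i
  | Sum.inr (Sum.inl j) => Sum.inr (Sum.inl j.1)
  | Sum.inr (Sum.inr (Sum.inl k)) => Sum.inr (Sum.inr k)
  | Sum.inr (Sum.inr (Sum.inr _)) => G.idx j₀

/-- `oldIdx` is injective. [folklore] -/
theorem oldIdx_injective : Injective (G.oldIdx j₀) := by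
  rintro (i | j | k | u) (i' | j' | k' | u') h <;>
    simp only [oldIdx, idx, Sum.inl.injEq, Sum.inr.injEq, reduceCtorEq] at h
  · rw [h]
  · rw [Subtype.ext h]
  · exact absurd h j.2
  · rw [h]
  · exact absurd h.symm j'.2
  · rfl

/-- An index is old iff it is not the cap. [folklore] -/
def IsOldIdx : (Cut).Idx → Prop
  | Sum.inr (Sum.inr (Sum.inr _)) => False
  | _ => True

/-- The footprint of an old index is `inlSet` of the old footprint. [folklore] -/
theorem cutPieces_foot_old {a : (Cut).Idx} (ha : G.IsOldIdx j₀ a) :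
    (Cut).foot a = (Dfar).inlSet (G.P.foot (G.oldIdx j₀ a)) ∧ G.oldIdx j₀ a ≠ G.idx j₀ := by
  rcases a with i | j | k | u
  · exact ⟨G.cutPieces_foot_inl j₀ i, by simp [oldIdx, idx]⟩
  · exact ⟨G.cutPieces_foot_ball j₀ j, by simpa [oldIdx, idx] using j.2⟩
  · exact ⟨G.cutPieces_foot_mball j₀ k, by simp [oldIdx, idx]⟩
  · exact absurd ha id

/-- **Footprints of the cut datum are disjoint.** [folklore] -/
theorem disjoint_foot_cutPieces (a a' : (Cut).Idx) (h : a ≠ a') : Disjoint ((Cut).foot a) ((Cut).foot a') := by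
  -- footprints of old indices are `inlSet` of the (disjoint) old footprints, the cap's footprint
  -- is `range inr ⊆ {inr 0} ∪ inlSet (footB j₀)`
  have hold : ∀ {a : (Cut).Idx}, G.IsOldIdx j₀ a → Disjoint ((Cut).foot a) (range (Dfar).glueData.inr) := by
    intro a ha
    obtain ⟨hfa, hne⟩ := G.cutPieces_foot_old j₀ ha
    rw [hfa, Set.disjoint_left]
    rintro p hp hq
    rcases G.range_inr_subset j₀ hq with rfl | hq
    · exact (Dfar).inr_zero_not_mem_inlSet _ hp
    · exact Set.disjoint_left.1 ((Dfar).disjoint_inlSet (G.disjoint_foot _ _ hne)) hp hq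
  by_cases ha : G.IsOldIdx j₀ a <;> by_cases ha' : G.IsOldIdx j₀ a'
  · obtain ⟨hfa, -⟩ := G.cutPieces_foot_old j₀ ha
    obtain ⟨hfa', -⟩ := G.cutPieces_foot_old j₀ ha'
    rw [hfa, hfa']
    exact (Dfar).disjoint_inlSet (G.disjoint_foot _ _ fun heq => h (G.oldIdx_injective j₀ heq))
  · rcases a' with i | j | k | u
    · exact absurd trivial ha'
    · exact absurd trivial ha'
    · exact absurd trivial ha'
    · exact hold ha
  · rcases a with i | j | k | u
    · exact absurd trivial ha
    · exact absurd trivial ha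
    · exact absurd trivial ha
    · exact (hold ha').symm
  · rcases a with i | j | k | u <;> rcases a' with i' | j' | k' | u'
    all_goals first | exact absurd trivial ha | exact absurd trivial ha' | exact absurd rfl h

/-- The old surgery-ball index of a new one. [folklore] -/
def oldIdxM : (Cut).IdxM → G.P.IdxM
  | Sum.inl ib => Sum.inl ib
  | Sum.inr (Sum.inl j) => Sum.inr (Sum.inl j.1)
  | Sum.inr (Sum.inr (Sum.inl k)) => Sum.inr (Sum.inr k)
  | Sum.inr (Sum.inr (Sum.inr _)) => Sum.inr (Sum.inl j₀)

/-- `oldIdxM` is injective. [folklore] -/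
theorem oldIdxM_injective : Injective (G.oldIdxM j₀) := by
  rintro (ib | j | k | u) (ib' | j' | k' | u') h <;>
    simp only [oldIdxM, Sum.inl.injEq, Sum.inr.injEq, reduceCtorEq] at h
  · rw [h]
  · rw [Subtype.ext h]
  · exact absurd h j.2
  · rw [h]
  · exact absurd h.symm j'.2
  · rfl

/-- The footprint in `M'` of a surgery ball of the cut datum lies in the old one. [folklore] -/
theorem footM'_cutPieces_subset (c : (Cut).IdxM) : (Cut).footM' c ⊆ G.P.footM' (G.oldIdxM j₀ c) := by
  rcases c with ⟨i, b⟩ | j | k | u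
  · exact Subset.rfl
  · exact Subset.rfl
  · exact Subset.rfl
  · change G.P.ballM j₀ '' closedBall 0 (collarRad (G.P.ballε j₀) (1 / 2)) ⊆ G.P.ballM j₀ '' closedBall 0 (1 + G.P.ballε j₀)
    exact image_mono (closedBall_subset_closedBall (collarRad_lt (G.P.ballε_pos j₀) _).le)

/-- **Footprints in `M'` of the cut datum are disjoint.** [folklore] -/
theorem disjoint_footM'_cutPieces (c c' : (Cut).IdxM) (h : c ≠ c') : Disjoint ((Cut).footM' c) ((Cut).footM' c') :=
  (G.disjoint_footM' _ _ fun heq => h (G.oldIdxM_injective j₀ heq)).mono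
    (G.footM'_cutPieces_subset j₀ c) (G.footM'_cutPieces_subset j₀ c')

/-! ### The common part of the cut datum -/

/-- The pieces of the cut datum at old indices are `inlSet` of the old pieces. [folklore] -/
theorem cutPieces_piece_old {a : (Cut).Idx} (ha : G.IsOldIdx j₀ a) : (Cut).piece a = (Dfar).inlSet (G.P.piece (G.oldIdx j₀ a)) := by
  rcases a with i | j | k | u
  · exact (Dfar).image_liftMap _ _ _
  · exact (Dfar).image_liftMap _ _ _
  · exact (Dfar).image_liftMap _ _ _
  · exact absurd ha id

/-- The new piece is the cap disc. [folklore] -/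
theorem cutPieces_piece_new (u : PUnit) : (Cut).piece (Sum.inr (Sum.inr (Sum.inr u))) = (Dfar).glueData.inr '' Metric.ball 0 1 := rfl

/-- The new index of an old index other than `j₀`. [folklore] -/
def newIdx : (b : G.P.Idx) → b ≠ G.idx j₀ → (Cut).Idx
  | Sum.inl i, _ => Sum.inl i
  | Sum.inr (Sum.inl j), h => Sum.inr (Sum.inl ⟨j, fun hj => h (by rw [hj])⟩)
  | Sum.inr (Sum.inr k), _ => Sum.inr (Sum.inr (Sum.inl k))

/-- `newIdx` produces old indices. [folklore] -/
theorem isOldIdx_newIdx (b : G.P.Idx) (hb : b ≠ G.idx j₀) : G.IsOldIdx j₀ (G.newIdx j₀ b hb) := by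
  rcases b with i | j | k <;> exact trivial

/-- `oldIdx ∘ newIdx = id`. [folklore] -/
theorem oldIdx_newIdx (b : G.P.Idx) (hb : b ≠ G.idx j₀) : G.oldIdx j₀ (G.newIdx j₀ b hb) = b := by
  rcases b with i | j | k <;> rfl

/-- The far side misses the piece `j₀`. [folklore] -/
theorem not_mem_pieceB_of_mem_farSet {p : Q} (hp : p ∈ ((Dfar).side : Set Q)) : p ∉ G.P.pieceB j₀ := fun hq =>
  hp (Or.inl (Or.inl hq))

/-- **A point `inl a` of the new common part projects to the old common part.** [folklore] -/
theorem mem_N_of_inl_mem_N {a : (Dfar).side} (h : (Dfar).glueData.inl a ∈ (Cut).N) : (a : Q) ∈ G.P.N := by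
  rw [GluePieces.mem_N_iff] at h ⊢
  intro b hb
  by_cases hbj : b = G.idx j₀
  · subst hbj
    exact G.not_mem_pieceB_of_mem_farSet j₀ a.2 hb
  · have h' := h (G.newIdx j₀ b hbj)
    rw [G.cutPieces_piece_old j₀ (G.isOldIdx_newIdx j₀ b hbj), oldIdx_newIdx, NeckCapData.inl_mem_inlSet_iff] at h'
    exact h' hb

/-- **A point of the old common part off the footprint of `j₀` gives a point of the new common
part.** [folklore] -/
theorem inl_mem_N {a : (Dfar).side} (ha : (a : Q) ∈ G.P.N) (haf : (a : Q) ∉ G.P.footB j₀) : (Dfar).glueData.inl a ∈ (Cut).N := by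
  rw [GluePieces.mem_N_iff]
  intro b hb
  by_cases hbo : G.IsOldIdx j₀ b
  · rw [G.cutPieces_piece_old j₀ hbo, NeckCapData.inl_mem_inlSet_iff] at hb
    exact ((GluePieces.mem_N_iff _).1 ha) _ hb
  · rcases b with i | j | k | u
    · exact hbo trivial
    · exact hbo trivial
    · exact hbo trivial
    · change (Dfar).glueData.inl a ∈ (Dfar).glueData.inr '' Metric.ball 0 1 at hb
      obtain ⟨y, -, hy⟩ := hb
      rcases G.range_inr_subset j₀ ⟨y, rfl⟩ with h0 | h1
      · have : (Dfar).glueData.inl a ∈ range (Dfar).glueData.inl := mem_range_self a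
        rw [(Dfar).range_inl, ← hy, h0] at this
        exact this rfl
      · rw [hy, NeckCapData.inl_mem_inlSet_iff] at h1
        exact haf h1

/-- `inlSet` of the old common part off the footprint of `j₀` lies in the new common part. [folklore] -/
theorem inlSet_N_subset : (Dfar).inlSet (G.P.N ∩ (G.P.footB j₀)ᶜ) ⊆ (Cut).N := by
  rintro _ ⟨a, ⟨ha, haf⟩, rfl⟩
  exact G.inl_mem_N j₀ ha haf

/-- **The new common part lies in the source of the transported `e`.** [folklore] -/
theorem N_subset_source_cutPieces : (Cut).N ⊆ (Cut).e.source := by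
  intro p hp
  rw [cutPieces_e, NeckCapData.transport_source_eq_inlSet]
  rcases (Dfar).glueData.exists_inl_or_inr p with ⟨a, rfl⟩ | ⟨y, rfl⟩
  · exact ⟨a, G.N_subset_source (G.mem_N_of_inl_mem_N j₀ hp), rfl⟩
  · rcases eq_or_ne y 0 with rfl | hy
    · exfalso
      rw [GluePieces.mem_N_iff] at hp
      exact hp (Sum.inr (Sum.inr (Sum.inr PUnit.unit))) ⟨0, by simp, rfl⟩
    · rw [G.inr_eq_inl_neck j₀ hy]
      exact ⟨_, G.neck_mem_source j₀ _ _, rfl⟩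

/-! ### The collar conditions of the cut datum -/

/-- Images under the transported `e` of `inlSet`s. [folklore] -/
theorem cut_e_image_inlSet_subset (S : Set Q) : (Cut).e '' (Dfar).inlSet S ⊆ G.P.e '' S :=
  (Dfar).transport_image_inlSet_subset G.P.e S

/-- Pull-backs under the transported `e` of subsets of its target. [folklore] -/
theorem cut_e_symm_image {T : Set M'} (hT : T ⊆ (Cut).e.target) : (Cut).e.symm '' T = (Dfar).inlSet (G.P.e.symm '' T) := by
  rw [cutPieces_e] at hT ⊢
  exact (Dfar).transport_symm_image hT

/-- `cut_target_subset`: elementary bookkeeping (cut target subset). [folklore] -/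
theorem cut_target_subset : (Cut).e.target ⊆ G.P.e.target := (Dfar).transport_target_subset G.P.e

/-- Tube ends: sphere condition. [folklore] -/
theorem tubeM_sphere_cut (i : G.P.It) (b : Bool) : (Cut).tubeM i b '' sphere 0 1 = (Cut).e '' (Cut).tubeSphere i b := by
  change G.P.tubeM i b '' sphere 0 1 = (Cut).e '' ((Dfar).liftMap (G.P.tube i) _ '' (univ ×ˢ {endHeight b}))
  rw [cutPieces_e, NeckCapData.transport_image_liftMap_image]
  exact G.tubeM_sphere i b

/-- Tube ends: inner condition. [folklore] -/
theorem tubeM_inner_cut (i : G.P.It) (b : Bool) :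
    (Cut).e.symm '' ((Cut).tubeM i b '' Metric.ball 0 1 ∩ (Cut).e.target) ⊆ (Cut).tube i '' (univ ×ˢ halfIoo b) := by
  change (Cut).e.symm '' (G.P.tubeM i b '' Metric.ball 0 1 ∩ (Cut).e.target) ⊆ (Dfar).liftMap (G.P.tube i) _ '' (univ ×ˢ halfIoo b)
  rw [G.cut_e_symm_image j₀ inter_subset_right, NeckCapData.image_liftMap]
  refine (Dfar).inlSet_mono ((image_mono (inter_subset_inter_right _ (G.cut_target_subset j₀))).trans (G.tubeM_inner i b))

/-- Tube ends: outer condition. [folklore] -/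
theorem tubeM_outer_cut (i : G.P.It) (b : Bool) :
    (Cut).e.symm '' ((Cut).tubeM i b '' outerAnnulus ((Cut).tubeε i b)) ⊆ (Cut).N := by
  change (Cut).e.symm '' (G.P.tubeM i b '' outerAnnulus (G.P.tubeε i b)) ⊆ (Cut).N
  have hsub : G.P.tubeM i b '' outerAnnulus (G.P.tubeε i b) ⊆ G.P.tubeM i b '' shell (G.P.tubeε i b) (G.P.tubeδ i b) :=
    image_mono (outerAnnulus_subset_shell (G.P.tubeδ_pos i b))
  rw [G.cut_e_symm_image j₀ (hsub.trans (G.tubeM_shell_subset_target j₀ i b))]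
  have hsub2 : G.P.e.symm '' (G.P.tubeM i b '' outerAnnulus (G.P.tubeε i b)) ⊆ G.P.N ∩ (G.P.footB j₀)ᶜ := fun p hp =>
    ⟨G.tubeM_outer i b hp, fun hf => Set.disjoint_left.1 (G.disjoint_foot (Sum.inl i) (G.idx j₀) (by simp [idx]))
      (G.symm_image_tubeM_shell_subset i b (image_mono hsub hp)) hf⟩
  exact ((Dfar).inlSet_mono hsub2).trans (G.inlSet_N_subset j₀)

/-- Ball pieces: sphere condition. [folklore] -/
theorem ballM_sphere_cut (j : {j : G.P.Ib // j ≠ j₀}) : (Cut).ballM j '' sphere 0 1 = (Cut).e '' (Cut).ballSphere j := by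
  change G.P.ballM j.1 '' sphere 0 1 = (Cut).e '' ((Dfar).liftMap (G.P.ball j.1) _ '' sphere 0 1)
  rw [cutPieces_e, NeckCapData.transport_image_liftMap_image]
  exact G.ballM_sphere j.1

/-- Ball pieces: inner condition. [folklore] -/
theorem ballM_inner_cut (j : {j : G.P.Ib // j ≠ j₀}) :
    (Cut).e.symm '' ((Cut).ballM j '' Metric.ball 0 1 ∩ (Cut).e.target) ⊆ (Cut).pieceB j := by
  change (Cut).e.symm '' (G.P.ballM j.1 '' Metric.ball 0 1 ∩ (Cut).e.target) ⊆ (Dfar).liftMap (G.P.ball j.1) _ '' Metric.ball 0 1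
  rw [G.cut_e_symm_image j₀ inter_subset_right, NeckCapData.image_liftMap]
  exact (Dfar).inlSet_mono ((image_mono (inter_subset_inter_right _ (G.cut_target_subset j₀))).trans (G.ballM_inner j.1))

/-- Ball pieces: outer condition. [folklore] -/
theorem ballM_outer_cut (j : {j : G.P.Ib // j ≠ j₀}) :
    (Cut).e.symm '' ((Cut).ballM j '' outerAnnulus ((Cut).ballε j)) ⊆ (Cut).N := by
  change (Cut).e.symm '' (G.P.ballM j.1 '' outerAnnulus (G.P.ballε j.1)) ⊆ (Cut).N
  have hsub : G.P.ballM j.1 '' outerAnnulus (G.P.ballε j.1) ⊆ G.P.ballM j.1 '' shell (G.P.ballε j.1) (G.P.ballδ j.1) :=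
    image_mono (outerAnnulus_subset_shell (G.P.ballδ_pos j.1))
  rw [G.cut_e_symm_image j₀ (hsub.trans (G.ballM_shell_subset_target j₀ j))]
  have hsub2 : G.P.e.symm '' (G.P.ballM j.1 '' outerAnnulus (G.P.ballε j.1)) ⊆ G.P.N ∩ (G.P.footB j₀)ᶜ := fun p hp =>
    ⟨G.ballM_outer j.1 hp, fun hf => Set.disjoint_left.1 (G.disjoint_foot _ (G.idx j₀) (by simpa [idx] using j.2))
      (G.symm_image_ballM_shell_subset j.1 (image_mono hsub hp)) hf⟩
  exact ((Dfar).inlSet_mono hsub2).trans (G.inlSet_N_subset j₀)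

/-! ### The matched balls of the cut datum -/

/-- `radialMap φ x = φ ‖x‖ • (x/‖x‖)`. [folklore] -/
theorem radialMap_eq_smul_unitDir (φ : ℝ → ℝ) {x : E} (hx : x ≠ 0) :
    radialMap φ x = φ ‖x‖ • (unitDir (unitSpherePoint n) x : E) := by
  rw [radialMap, coe_unitDir_of_ne _ hx, smul_smul]

/-- Matching of the old matched balls. [folklore] -/
theorem mball_match_old (k : G.P.Im) (x : E) (hx : x ≠ 0) :
    (Cut).mball (Sum.inl k) x ∈ (Cut).e.source ∧ (Cut).e ((Cut).mball (Sum.inl k) x) = (Cut).mballM (Sum.inl k) (radialMap ((Cut).mprof (Sum.inl k)) x) := by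
  obtain ⟨h1, h2⟩ := G.mball_match k x hx
  change (Dfar).liftMap (G.P.mball k) _ x ∈ ((Dfar).transport G.P.e).source ∧
    (Dfar).transport G.P.e ((Dfar).liftMap (G.P.mball k) _ x) = G.P.mballM k (radialMap (G.P.mprof k) x)
  rw [NeckCapData.liftMap_apply, NeckCapData.inl_mem_transport_source, NeckCapData.transport_inl]
  exact ⟨h1, h2⟩

/-- **Matching of the cap**: `e (ψ (x/‖x‖, ‖x‖)) = ι' ((1 + ε ρ ‖x‖) • x/‖x‖)`. [folklore] -/
theorem mball_match_new (u : PUnit) (x : E) (hx : x ≠ 0) :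
    (Cut).mball (Sum.inr u) x ∈ (Cut).e.source ∧ (Cut).e ((Cut).mball (Sum.inr u) x) = (Cut).mballM (Sum.inr u) (radialMap ((Cut).mprof (Sum.inr u)) x) := by
  change (Dfar).glueData.inr x ∈ ((Dfar).transport G.P.e).source ∧
    (Dfar).transport G.P.e ((Dfar).glueData.inr x) = G.P.ballM j₀ (radialMap (collarRad (G.P.ballε j₀)) x)
  rw [G.inr_eq_inl_neck j₀ hx, NeckCapData.inl_mem_transport_source, NeckCapData.transport_inl]
  refine ⟨G.neck_mem_source j₀ _ _, ?_⟩
  change G.P.e ((G.collar j₀).neck (unitDir (unitSpherePoint n) x, ‖x‖)) = _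
  rw [G.e_neck j₀, radialMap_eq_smul_unitDir (n := n) _ hx]

/-- Deep condition of the old matched balls. [folklore] -/
theorem mballM_deep_old (k : G.P.Im) :
    Disjoint ((Cut).mballM (Sum.inl k) '' closedBall 0 ((Cut).mprof (Sum.inl k) (1 / 2))) ((Cut).e '' ((Cut).e.source \ (Cut).pieceM (Sum.inl k))) := by
  change Disjoint (G.P.mballM k '' closedBall 0 (G.P.mprof k (1 / 2))) ((Cut).e '' ((Cut).e.source \ (Dfar).liftMap (G.P.mball k) _ '' Metric.ball 0 1))
  refine (G.mballM_deep k).mono_right ?_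
  rw [cutPieces_e, NeckCapData.transport_source_eq_inlSet, NeckCapData.image_liftMap]
  exact (image_mono ((Dfar).inlSet_diff_subset _ _)).trans ((Dfar).transport_image_inlSet_subset G.P.e _)

/-- **Deep condition of the cap**: the surgery ball of `j₀` up to radius `1 + ε ρ(1/2)` meets
the image of the new common part and of the other pieces only inside the cap piece. [folklore] -/
theorem mballM_deep_new (u : PUnit) :
    Disjoint ((Cut).mballM (Sum.inr u) '' closedBall 0 ((Cut).mprof (Sum.inr u) (1 / 2))) ((Cut).e '' ((Cut).e.source \ (Cut).pieceM (Sum.inr u))) := by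
  change Disjoint (G.P.ballM j₀ '' closedBall 0 (collarRad (G.P.ballε j₀) (1 / 2)))
    ((Dfar).transport G.P.e '' (((Dfar).transport G.P.e).source \ (Dfar).glueData.inr '' Metric.ball 0 1))
  set ε := G.P.ballε j₀ with hε
  have hεp : 0 < ε := G.P.ballε_pos j₀
  rw [Set.disjoint_left]
  rintro _ ⟨y, hy, rfl⟩ ⟨p, ⟨hps, hpn⟩, hpy⟩
  rw [mem_closedBall_zero_iff] at hy
  rw [NeckCapData.transport_source_eq_inlSet] at hps
  obtain ⟨a, ha, rfl⟩ := hps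
  rw [NeckCapData.transport_inl] at hpy
  -- `e a = ι' y`, so `a = c y`
  have hyt : G.P.ballM j₀ y ∈ G.P.e.target := by rw [← hpy]; exact G.P.e.map_source ha
  have hay : (a : Q) = G.collarChart j₀ y := by
    rw [collarChart_apply, ← hpy, G.P.e.left_inv ha]
  have hafar : (a : Q) ∈ (G.collar j₀).farSet := a.2
  have hy1ε : ‖y‖ < 1 + ε := hy.trans_lt (collarRad_lt hεp _)
  rcases lt_or_ge ‖y‖ 1 with hy1 | hy1
  · -- `‖y‖ < 1`: `a` is in the piece `j₀`, not in the far side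
    have : (a : Q) ∈ G.P.pieceB j₀ := G.ballM_inner j₀ ⟨_, ⟨⟨y, mem_ball_zero_iff.2 hy1, rfl⟩, hyt⟩, hay.symm⟩
    exact G.not_mem_pieceB_of_mem_farSet j₀ hafar this
  · have hy0 : y ≠ 0 := by rintro rfl; rw [norm_zero] at hy1; linarith
    set θ : sphere (0 : E) 1 := unitDir (unitSpherePoint n) y with hθ
    have hyθ : y = ‖y‖ • (θ : E) := (norm_smul_coe_unitDir (unitSpherePoint n) hy0).symm
    rcases lt_trichotomy ‖y‖ (collarRad ε 0) with hlt | heq | hgt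
    · -- below the middle sphere: in the near side
      have : (a : Q) ∈ (G.collar j₀).nearSet := by
        rw [hay, hyθ]; exact (G.collar j₀).smul_mem_nearSet θ hy1 hlt
      exact hafar (Or.inl this)
    · -- on the middle sphere
      have : (a : Q) ∈ (G.collar j₀).midSphere := by
        rw [hay]; exact ⟨y, mem_sphere_zero_iff_norm.2 heq, rfl⟩
      exact hafar (Or.inr this)
    · -- above the middle sphere up to `r (1/2)`: a point of the capped half-neck with `t ≤ 1/2`
      set t : ℝ := collarRadInv ε ‖y‖ with ht
      have hrt : collarRad ε t = ‖y‖ := collarRad_collarRadInv hεp ⟨(one_lt_collarRad hεp 0).trans hgt, hy1ε⟩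
      have htpos : 0 < t := by rw [← collarRad_zero_lt_iff hεp, hrt]; exact hgt
      have hthalf : t ≤ 1 / 2 := by rw [← (strictMono_collarRad hεp).le_iff_le, hrt]; exact hy
      have hneck : (G.collar j₀).neck (θ, t) = (a : Q) := by
        rw [neck_apply, ← collarChart_apply]
        change G.collarChart j₀ (collarRad ε t • (θ : E)) = (a : Q)
        rw [hrt, ← hyθ, hay]
      have key := (Dfar).inl_eq_inr θ htpos
      apply hpn
      refine ⟨t • (θ : E), ?_, ?_⟩
      · rw [mem_ball_zero_iff, BallCollarData.norm_smul_sphere θ htpos]; linarith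
      · rw [← key]; congr 1; exact Subtype.ext hneck

/-- **The reconstruction datum of the far capped side.** [cite: Hamilton1997, §1.1 pp. 3–4] -/
def ballCut : SurgeryGlueData E n (Dfar).Capped M' where
  P := G.cutPieces j₀
  N_subset_source := G.N_subset_source_cutPieces j₀
  disjoint_foot := G.disjoint_foot_cutPieces j₀
  disjoint_footM' := G.disjoint_footM'_cutPieces j₀
  tubeM_shell := G.tubeM_shell_subset_target j₀
  tubeM_sphere := G.tubeM_sphere_cut j₀
  tubeM_inner := G.tubeM_inner_cut j₀
  tubeM_outer := G.tubeM_outer_cut j₀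
  ballM_shell := G.ballM_shell_subset_target j₀
  ballM_sphere := G.ballM_sphere_cut j₀
  ballM_inner := G.ballM_inner_cut j₀
  ballM_outer := G.ballM_outer_cut j₀
  mball_match k x hx := by
    rcases k with k | u
    · exact G.mball_match_old j₀ k x hx
    · exact G.mball_match_new j₀ u x hx
  mballM_deep k := by
    rcases k with k | u
    · exact G.mballM_deep_old j₀ k
    · exact G.mballM_deep_new j₀ u

/-- **Cutting a ball piece lowers the complexity by one.** [folklore] -/
theorem complexity_ballCut : (G.ballCut j₀).complexity + 1 = G.complexity := by
  classical
  change 3 * Fintype.card G.P.It + Fintype.card {j : G.P.Ib // j ≠ j₀} + 1 = 3 * Fintype.card G.P.It + Fintype.card G.P.Ib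
  have h1 : Fintype.card {j : G.P.Ib // j ≠ j₀} = Fintype.card G.P.Ib - 1 := by
    rw [show Fintype.card {j : G.P.Ib // j ≠ j₀} = Fintype.card {j : G.P.Ib // ¬ j = j₀} from rfl,
      Fintype.card_subtype_compl, Fintype.card_subtype_eq]
  have h2 : 0 < Fintype.card G.P.Ib := Fintype.card_pos_iff.2 ⟨j₀⟩
  omega

end SurgeryGlueData

end Literature.Topology.FourManifolds

end
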